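import Summits.CriticalPhenomena.PercolationContinuityZ3.Theorems.PercNearOneGluingNoHeavyQuantShapePieceBlob
import HarnessLib

/-!
# QUANT lane R8, T-DEC: ALGEBRA OF THE LONG-TAIL PAIR HUB — the closed-form inequalities behind the torque-cost certificate of the width-2 hub
# `S(γ₁) ∗ S(γ₂)` of shape `{lo, lo+K; γ}` with a LONG tail `2lo < K ≤ 4lo` at EVERY gate `γᵢ ≥ lo/K` (census-1 gen 32)

builds on p205010 (kernel theorem, internal audit signed; external expert review pending)

Support file (`--supports stmt-CriticalPhenomena-4575`), QUANT lane seat prim-quant-census-1 (gen 32); memo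
`run/shared/lean/prim/quant/prim-quant-census-1/g32/TWOLO-G32.md` §3–§4.  Theorems only (no definitions), standard axioms, no sorries; pure real
algebra (the SDEC theorem is `…QuantLongTailPairHub`).

THE OBJECT.  The width-2 hub has atoms `2lo, 2lo+K, 2lo+2K` with masses `u₀ = (1−g)(1−h)`, `u₁ = g(1−h) + h(1−g)`, `u₂ = gh` (`g ≤ h` the two piece
gates, `lo ≤ Kg`), mean `T₀ = 2lo + K(g+h)`, floor `x(lo+K) ≤ lo + Kg`.  For `K > 2lo` the middle atom is FAR for `T ≤ 2lo+K` and incompatible for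
`T ≥ 4lo+K`, so the one low `2lo` ships either to the middle (while its credit capacity lasts: `(T−4lo)(u₀+u₁) ≤ K·u₁`) or to the top, with torque
cost.  The certificates below were FOUND by an exact Handelman/Positivstellensatz LP uniform in `c = lo/K ∈ [1/4, 1/2]` (memo §4, code/psatz3.py) and
are checked here by `linarith` over the listed products:
* **`ltPair_capRho`** — the top's credit capacity, UNCONDITIONAL: `(K(g+h) − 2lo)(u₀+u₂) ≤ 2K·u₂` (17-term certificate; `= 2lo·K − K·u₁(K+2lo−K(g+h))`).
* **`ltPair_noCredit`** — `h(2Kg+lo) ≤ lo+Kg ⟹ gh(2K+2lo−K(g+h)) ≤ 2lo`: below the hyperbola `h = (lo+Kg)/(2Kg+lo)` the middle atom's credit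
  capacity is never exhausted (11-term certificate), whence **`ltPair_capTop`** — if it IS exhausted at `a = 1` then `(lo+Kg)(u₀+u₂) ≤ (lo+K)u₂`
  (the top's floor capacity; `⟺ h(2Kg+lo) ≥ lo+Kg`).
* **`ltPair_above`** — exhausted credit capacity forces `K·u₁ ≥ (K−2lo)(u₀+u₁)`, i.e. the switch happens above the middle atom (11-term certificate).
* **`ltPair_capMid`** — the middle's floor capacity `(lo+Kg)(u₀+u₁) ≤ (lo+K)u₁` (`= (1−g)[lo(1−h) − Kh(1−g)] ≤ 0`).
* **`ltPair_quartic`** (`8lo³K ≥ (K²−3loK−lo²)²` on `2lo ≤ K ≤ 4lo`), **`ltPair_S_nonneg`** (the symmetric-corner quadratic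
  `4loKg² + (6loK+2lo²−2K²)g + 2lo² ≥ 0` by completing the square), **`ltPair_cost0`** — the torque cost at the switching point:
  `(lo+Kg)(1−h)[(2K−2lo)u₀ + (K−2lo)u₁] ≤ 2loK(u₀+u₁)²` (as a quadratic form `2loK·e₁² + A·e₁e₂ + B·e₂²` in `eᵢ = 1−γᵢ`, `e₂ ≤ e₁`, with `A ≥ 0`;
  if `B < 0` the form is concave along `e₂` and its values at `e₂ = 0`, `e₂ = e₁` are `2loK·e₁² ≥ 0`, `S·e₁² ≥ 0`).
* **`quad_concave_between`** — a concave quadratic nonnegative at two points is nonnegative between them (the cost at intermediate gates).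

HONEST STATUS.  Algebra only; `SiblingStep`, `GluedDominatedMass`, `SDECConvClosed`, `FarTreeRow` OPEN; RATE class (log\*) / honest sentence of
`run/shared/lean/prim/quant/README.md` unchanged.  [this work].  Handelman's Positivstellensatz for polytopes is classical; nothing here is cited as a
published result.  The gluing rows served [cite: KozmaNitzan2024, Conjecture 3 (p. 15)]; product measure [cite: Grimmett1999, §1.3 p. 10].
-/

noncomputable section

namespace Summit.CriticalPhenomena.PercolationContinuityZ3.Theorems
namespace Quant
namespace LawDec

/-! ### Capacities -/

/-- **the top's credit capacity, unconditional** (`2lo ≤ K ≤ 4lo`, gates `≥ lo/K`): `(K(g+h) − 2lo)((1−g)(1−h) + gh) ≤ 2K·gh`.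
Certificate: 17 products of `Kg−lo, Kh−lo, 1−g, 1−h, 4lo−K, K−2lo, K` (exact LP, uniform in `lo/K ∈ [1/4,1/2]`; `linarith` may discard some of them). [this work] -/
theorem ltPair_capRho (lo K g h : ℝ) (hlo : 0 < lo) (hK2 : 2 * lo ≤ K) (hK4 : K ≤ 4 * lo) (hg : lo ≤ K * g) (hh : lo ≤ K * h)
    (hg1 : g ≤ 1) (hh1 : h ≤ 1) : (K * (g + h) - 2 * lo) * ((1 - g) * (1 - h) + g * h) ≤ 2 * K * (g * h) := by
  have hA : 0 ≤ K * g - lo := sub_nonneg.2 hg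
  have hB : 0 ≤ K * h - lo := sub_nonneg.2 hh
  have hE1 : 0 ≤ 1 - g := by linarith
  have hE2 : 0 ≤ 1 - h := by linarith
  have hC4 : 0 ≤ 4 * lo - K := by linarith
  have hC2 : 0 ≤ K - 2 * lo := by linarith
  have hK : 0 < K := by linarith
  have key : 0 ≤ K * (2 * K * (g * h) - (K * (g + h) - 2 * lo) * ((1 - g) * (1 - h) + g * h)) := by
    linarith [mul_nonneg hC4 hK.le, mul_nonneg hC4 hC4, mul_nonneg (mul_nonneg hE2 hC4) hC2, mul_nonneg (mul_nonneg hE2 hE2) (mul_nonneg hC2 hK.le),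
      mul_nonneg (mul_nonneg hE1 hC4) hC2, mul_nonneg (mul_nonneg hE1 hE1) (mul_nonneg hE2 (mul_nonneg hK.le hK.le)),
      mul_nonneg hB hC4, mul_nonneg (mul_nonneg hB hE2) hK.le, mul_nonneg (mul_nonneg hB hE2) hC4, mul_nonneg (mul_nonneg hB hE1) hC4,
      mul_nonneg (mul_nonneg hB hB) hE1, mul_nonneg hA hC4, mul_nonneg (mul_nonneg hA hE1) hC4, mul_nonneg hA hB,
      mul_nonneg (mul_nonneg hA hB) hE2, mul_nonneg (mul_nonneg hA hB) hE1, mul_nonneg hA hA]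
  nlinarith [key]

/-- **no exhausted credit below the hyperbola**: `h(2Kg+lo) ≤ lo+Kg`, `g ≤ h ≤ 1`, `2lo ≤ K ≤ 4lo` ⟹ `gh(2K+2lo−K(g+h)) ≤ 2lo`.
Certificate: 11 products of `1−h, h−g, (lo+Kg)−h(2Kg+lo), 4lo−K, K−2lo, K` (exact LP). [this work] -/
theorem ltPair_noCredit (lo K g h : ℝ) (hlo : 0 < lo) (hK2 : 2 * lo ≤ K) (hK4 : K ≤ 4 * lo) (hgh : g ≤ h) (hh1 : h ≤ 1)
    (hd : h * (2 * K * g + lo) ≤ lo + K * g) : g * h * (2 * K + 2 * lo - K * (g + h)) ≤ 2 * lo := by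
  have hE2 : 0 ≤ 1 - h := by linarith
  have hHG : 0 ≤ h - g := by linarith
  have hD : 0 ≤ lo + K * g - h * (2 * K * g + lo) := by linarith
  have hC4 : 0 ≤ 4 * lo - K := by linarith
  have hC2 : 0 ≤ K - 2 * lo := by linarith
  have hK : 0 < K := by linarith
  have key : 0 ≤ K * (2 * lo - g * h * (2 * K + 2 * lo - K * (g + h))) := by
    linarith [mul_nonneg hC4 hK.le, mul_nonneg hD hC4, mul_nonneg (mul_nonneg hHG hC4) hK.le, mul_nonneg (mul_nonneg hHG hD) hK.le,
      mul_nonneg (mul_nonneg hHG hHG) (mul_nonneg hK.le hK.le), mul_nonneg (mul_nonneg hE2 hC4) hC2, mul_nonneg (mul_nonneg hE2 hD) hK.le,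
      mul_nonneg (mul_nonneg hE2 hHG) (mul_nonneg hK.le hK.le), mul_nonneg (mul_nonneg hE2 hHG) (mul_nonneg hC2 hK.le),
      mul_nonneg (mul_nonneg hE2 hE2) (mul_nonneg hK.le hK.le), mul_nonneg (mul_nonneg hE2 hE2) (mul_nonneg hC2 hK.le)]
  nlinarith [key]

/-- **the top's floor capacity when the middle's credit is exhausted**: `g ≤ h ≤ 1`, `2lo ≤ K ≤ 4lo` and `gh(2K+2lo−K(g+h)) > 2lo` ⟹
`(lo+Kg)((1−g)(1−h) + gh) ≤ (lo+K)·gh` (`⟺ h(2Kg+lo) ≥ lo+Kg`, the contrapositive of `ltPair_noCredit`). [this work] -/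
theorem ltPair_capTop (lo K g h : ℝ) (hlo : 0 < lo) (hK2 : 2 * lo ≤ K) (hK4 : K ≤ 4 * lo) (hgh : g ≤ h) (hh1 : h ≤ 1)
    (htop : 2 * lo < g * h * (2 * K + 2 * lo - K * (g + h))) : (lo + K * g) * ((1 - g) * (1 - h) + g * h) ≤ (lo + K) * (g * h) := by
  have hd : lo + K * g < h * (2 * K * g + lo) := by
    by_contra hc
    push Not at hc
    exact absurd (ltPair_noCredit lo K g h hlo hK2 hK4 hgh hh1 hc) (not_le.2 htop)
  have hE1 : 0 ≤ 1 - g := by linarith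
  -- `(lo+Kg)(u₀+u₂) − (lo+K)u₂ = (1−g)·[(lo+Kg)(1−h) − Kgh] = (1−g)·[(lo+Kg) − h(2Kg+lo)]`
  have e : (lo + K) * (g * h) - (lo + K * g) * ((1 - g) * (1 - h) + g * h) = (1 - g) * (h * (2 * K * g + lo) - (lo + K * g)) := by ring
  nlinarith [mul_nonneg hE1 (sub_nonneg.2 hd.le)]

/-- **exhausted credit happens above the middle atom**: `gh(2K+2lo−K(g+h)) ≥ 2lo` (the middle's credit capacity exhausted at `a = 1`), gates in
`[lo/K, 1]`, `2lo ≤ K ≤ 4lo` ⟹ `K·(g+h−2gh) ≥ (K−2lo)(1−gh)`, i.e. the switching target `4lo + K·u₁/(u₀+u₁)` is at least `2lo + K`.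
Certificate: 11 products incl. the premise (exact LP). [this work] -/
theorem ltPair_above (lo K g h : ℝ) (hlo : 0 < lo) (hK2 : 2 * lo ≤ K) (hK4 : K ≤ 4 * lo) (hg : lo ≤ K * g) (hh : lo ≤ K * h)
    (hg1 : g ≤ 1) (hh1 : h ≤ 1) (htop : 2 * lo ≤ g * h * (2 * K + 2 * lo - K * (g + h))) :
    (K - 2 * lo) * (1 - g * h) ≤ K * (g + h - 2 * (g * h)) := by
  have hA : 0 ≤ K * g - lo := by linarith
  have hB : 0 ≤ K * h - lo := by linarith
  have hE1 : 0 ≤ 1 - g := by linarith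
  have hE2 : 0 ≤ 1 - h := by linarith
  have hC4 : 0 ≤ 4 * lo - K := by linarith
  have hK : 0 < K := by linarith
  have hP : 0 ≤ g * h * (2 * K + 2 * lo - K * (g + h)) - 2 * lo := by linarith
  have key : 0 ≤ K * (K * (g + h - 2 * (g * h)) - (K - 2 * lo) * (1 - g * h)) := by
    linarith [mul_nonneg hP hK.le, mul_nonneg (mul_nonneg hE2 hC4) hK.le, mul_nonneg (mul_nonneg hE2 hE2) (mul_nonneg hK.le hK.le),
      mul_nonneg (mul_nonneg hE2 hE2) (mul_nonneg hC4 hK.le), mul_nonneg (mul_nonneg hE1 hC4) hK.le, mul_nonneg hE1 (mul_nonneg hC4 hC4),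
      mul_nonneg (mul_nonneg hE1 hE1) (mul_nonneg hK.le hK.le), mul_nonneg (mul_nonneg hE1 hE1) (mul_nonneg hC4 hK.le),
      mul_nonneg (mul_nonneg hB hE1) hC4, mul_nonneg (mul_nonneg hB hE1) (mul_nonneg hE1 hK.le), mul_nonneg (mul_nonneg hA hE2) (mul_nonneg hE2 hK.le)]
  nlinarith [key]

/-- **the middle's floor capacity**: `g ≤ h ≤ 1`, `lo ≤ Kg` ⟹ `(lo+Kg)((1−g)(1−h) + g(1−h) + h(1−g)) ≤ (lo+K)(g(1−h) + h(1−g))`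
(`(lo+K)u₁ − (lo+Kg)(u₀+u₁) = (1−g)[Kh(1−g) − lo(1−h)] ≥ 0`). [this work] -/
theorem ltPair_capMid (lo K g h : ℝ) (hK : 0 ≤ K) (hg : lo ≤ K * g) (hgh : g ≤ h) (hh1 : h ≤ 1) :
    (lo + K * g) * ((1 - g) * (1 - h) + (g * (1 - h) + h * (1 - g))) ≤ (lo + K) * (g * (1 - h) + h * (1 - g)) := by
  have hE1 : 0 ≤ 1 - g := by linarith
  have hE2 : 0 ≤ 1 - h := by linarith
  have e : (lo + K) * (g * (1 - h) + h * (1 - g)) - (lo + K * g) * ((1 - g) * (1 - h) + (g * (1 - h) + h * (1 - g)))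
      = (1 - g) * (K * h * (1 - g) - lo * (1 - h)) := by ring
  have h1 : lo * (1 - h) ≤ K * g * (1 - h) := mul_le_mul_of_nonneg_right hg hE2
  have h2 : K * g * (1 - h) ≤ K * h * (1 - g) := by nlinarith [mul_nonneg hK (sub_nonneg.2 hgh)]
  nlinarith [mul_nonneg hE1 (show 0 ≤ K * h * (1 - g) - lo * (1 - h) by linarith)]

/-! ### The cost at the switching point -/

/-- `8lo³K ≥ (K² − 3loK − lo²)²` for `2lo ≤ K ≤ 4lo` (with `K = 2lo + d`: `7lo⁴ + 14lo³d + 5lo²d² − 2lod³ − d⁴ ≥ 0` for `0 ≤ d ≤ 2lo`). [this work] -/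
theorem ltPair_quartic (lo K : ℝ) (hlo : 0 < lo) (hK2 : 2 * lo ≤ K) (hK4 : K ≤ 4 * lo) :
    (K ^ 2 - 3 * lo * K - lo ^ 2) ^ 2 ≤ 8 * lo ^ 3 * K := by
  have hd : 0 ≤ K - 2 * lo := by linarith
  have hd2 : K - 2 * lo ≤ 2 * lo := by linarith
  set d : ℝ := K - 2 * lo with hdd
  have eK : K = 2 * lo + d := by rw [hdd]; ring
  rw [eK]
  have e : 8 * lo ^ 3 * (2 * lo + d) - ((2 * lo + d) ^ 2 - 3 * lo * (2 * lo + d) - lo ^ 2) ^ 2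
      = 7 * lo ^ 4 + 14 * lo ^ 3 * d + 5 * lo ^ 2 * d ^ 2 - 2 * lo * d ^ 3 - d ^ 4 := by ring
  have h3 : d ^ 3 ≤ 2 * lo * d ^ 2 := by nlinarith [mul_nonneg (sq_nonneg d) (sub_nonneg.2 hd2)]
  have h4 : d ^ 4 ≤ 4 * lo ^ 2 * d ^ 2 := by nlinarith [mul_nonneg (sq_nonneg d) (sub_nonneg.2 hd2), mul_nonneg (sq_nonneg d) hd]
  have h5 : lo ^ 2 * d ^ 2 ≤ 2 * lo ^ 3 * d := by nlinarith [mul_nonneg (mul_nonneg hlo.le hlo.le) (mul_nonneg hd (sub_nonneg.2 hd2))]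
  have h3' : 2 * lo * d ^ 3 ≤ 4 * lo ^ 2 * d ^ 2 := by nlinarith [mul_le_mul_of_nonneg_left h3 (by linarith : (0 : ℝ) ≤ 2 * lo)]
  have h6 : 0 ≤ lo ^ 3 * d := mul_nonneg (pow_nonneg hlo.le 3) hd
  have h7 : 0 < lo ^ 4 := pow_pos hlo 4
  rw [← sub_nonneg, e]
  linarith

/-- the symmetric-corner quadratic is nonnegative: `4loKg² + (6loK + 2lo² − 2K²)g + 2lo² ≥ 0` for `2lo ≤ K ≤ 4lo` (completing the square:
`4loK·S = (4loKg + 3loK + lo² − K²)² + (8lo³K − (K²−3loK−lo²)²)`). [this work] -/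
theorem ltPair_S_nonneg (lo K g : ℝ) (hlo : 0 < lo) (hK2 : 2 * lo ≤ K) (hK4 : K ≤ 4 * lo) :
    0 ≤ 4 * lo * K * g ^ 2 + (6 * lo * K + 2 * lo ^ 2 - 2 * K ^ 2) * g + 2 * lo ^ 2 := by
  have hK : 0 < K := by linarith
  have e : 4 * lo * K * (4 * lo * K * g ^ 2 + (6 * lo * K + 2 * lo ^ 2 - 2 * K ^ 2) * g + 2 * lo ^ 2)
      = (4 * lo * K * g + 3 * lo * K + lo ^ 2 - K ^ 2) ^ 2 + (8 * lo ^ 3 * K - (K ^ 2 - 3 * lo * K - lo ^ 2) ^ 2) := by ring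
  have hq := ltPair_quartic lo K hlo hK2 hK4
  have h4 : 0 < 4 * lo * K := by positivity
  have : 0 ≤ 4 * lo * K * (4 * lo * K * g ^ 2 + (6 * lo * K + 2 * lo ^ 2 - 2 * K ^ 2) * g + 2 * lo ^ 2) := by
    rw [e]; nlinarith [sq_nonneg (4 * lo * K * g + 3 * lo * K + lo ^ 2 - K ^ 2)]
  exact nonneg_of_mul_nonneg_right this h4

/-- **the torque cost at the switching point** (`2lo ≤ K ≤ 4lo`, `lo ≤ Kg`, `g ≤ h ≤ 1`):
`(lo+Kg)(1−h)[(2K−2lo)(1−g)(1−h) + (K−2lo)(g(1−h)+h(1−g))] ≤ 2loK(1−gh)²`.  With `e₁ = 1−g ≥ e₂ = 1−h` the slack is the quadratic form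
`2loK·e₁² + A·e₁e₂ + B·e₂²`, `A = Kg(6lo−K) − lo(K−2lo) ≥ 0`; for `B < 0` use `e₁·slack = 2loK·e₁²(e₁−e₂) + S·e₁²e₂ + (−B)·e₁e₂(e₁−e₂)` with
`S = 2loK + A + B` the quadratic of `ltPair_S_nonneg`. [this work] -/
theorem ltPair_cost0 (lo K g h : ℝ) (hlo : 0 < lo) (hK2 : 2 * lo ≤ K) (hK4 : K ≤ 4 * lo) (hg : lo ≤ K * g) (hgh : g ≤ h) (hh1 : h ≤ 1) :
    (lo + K * g) * (1 - h) * ((2 * K - 2 * lo) * ((1 - g) * (1 - h)) + (K - 2 * lo) * (g * (1 - h) + h * (1 - g)))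
      ≤ 2 * lo * K * (1 - g * h) ^ 2 := by
  have hK : 0 < K := by linarith
  set e₁ : ℝ := 1 - g with he₁
  set e₂ : ℝ := 1 - h with he₂
  have hE1 : 0 ≤ e₁ := by rw [he₁]; linarith
  have hE2 : 0 ≤ e₂ := by rw [he₂]; linarith
  have hE12 : e₂ ≤ e₁ := by rw [he₁, he₂]; linarith
  set A : ℝ := K * g * (6 * lo - K) - lo * (K - 2 * lo) with hA
  set B : ℝ := g * (4 * lo * K * g + 2 * lo ^ 2 - K ^ 2) - lo * K with hB
  have eS : 2 * lo * K + A + B = 4 * lo * K * g ^ 2 + (6 * lo * K + 2 * lo ^ 2 - 2 * K ^ 2) * g + 2 * lo ^ 2 := by rw [hA, hB]; ring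
  have hS : 0 ≤ 2 * lo * K + A + B := by rw [eS]; exact ltPair_S_nonneg lo K g hlo hK2 hK4
  have hApos : 0 ≤ A := by
    rw [hA]
    have h1 : lo * (6 * lo - K) ≤ K * g * (6 * lo - K) := mul_le_mul_of_nonneg_right hg (by linarith)
    nlinarith
  have e : 2 * lo * K * (1 - g * h) ^ 2
      - (lo + K * g) * (1 - h) * ((2 * K - 2 * lo) * ((1 - g) * (1 - h)) + (K - 2 * lo) * (g * (1 - h) + h * (1 - g)))
      = 2 * lo * K * e₁ ^ 2 + A * (e₁ * e₂) + B * e₂ ^ 2 := by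
    rw [he₁, he₂, hA, hB]; ring
  rw [← sub_nonneg, e]
  by_cases hB0 : 0 ≤ B
  · have : 0 ≤ 2 * lo * K * e₁ ^ 2 := by positivity
    nlinarith [mul_nonneg hApos (mul_nonneg hE1 hE2), mul_nonneg hB0 (sq_nonneg e₂)]
  · have hBn : 0 ≤ -B := by linarith
    rcases eq_or_lt_of_le hE1 with h0 | hpos
    · -- `g = 1`, hence `h = 1`
      have e1z : e₁ = 0 := h0.symm
      have e2z : e₂ = 0 := le_antisymm (by rw [← e1z]; exact hE12) hE2
      rw [e1z, e2z]; simp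
    · have key : e₁ * (2 * lo * K * e₁ ^ 2 + A * (e₁ * e₂) + B * e₂ ^ 2)
          = 2 * lo * K * (e₁ ^ 2 * (e₁ - e₂)) + (2 * lo * K + A + B) * (e₁ ^ 2 * e₂) + (-B) * (e₁ * e₂ * (e₁ - e₂)) := by ring
      have hnn : 0 ≤ e₁ * (2 * lo * K * e₁ ^ 2 + A * (e₁ * e₂) + B * e₂ ^ 2) := by
        rw [key]
        have t1 : 0 ≤ 2 * lo * K * (e₁ ^ 2 * (e₁ - e₂)) := by
          have : 0 ≤ e₁ ^ 2 * (e₁ - e₂) := mul_nonneg (sq_nonneg _) (sub_nonneg.2 hE12)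
          positivity
        have t2 : 0 ≤ (2 * lo * K + A + B) * (e₁ ^ 2 * e₂) := mul_nonneg hS (mul_nonneg (sq_nonneg _) hE2)
        have t3 : 0 ≤ (-B) * (e₁ * e₂ * (e₁ - e₂)) := mul_nonneg hBn (mul_nonneg (mul_nonneg hE1 hE2) (sub_nonneg.2 hE12))
        linarith
      exact nonneg_of_mul_nonneg_right hnn hpos

/-! ### Concavity -/

/-- **a concave quadratic nonnegative at two points is nonnegative between them**: `κ ≥ 0`, `Ψ(t) = α + βt − κt²`, `Ψ(τ) ≥ 0`, `Ψ(T₀) ≥ 0`,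
`τ ≤ T ≤ T₀` ⟹ `Ψ(T) ≥ 0` (`(T₀−τ)Ψ(T) = (T₀−T)Ψ(τ) + (T−τ)Ψ(T₀) + κ(T−τ)(T₀−T)(T₀−τ)`). [this work] -/
theorem quad_concave_between {α β κ τ T₀ T : ℝ} (hκ : 0 ≤ κ) (h1 : 0 ≤ α + β * τ - κ * τ ^ 2) (h2 : 0 ≤ α + β * T₀ - κ * T₀ ^ 2)
    (hτT : τ ≤ T) (hTT : T ≤ T₀) : 0 ≤ α + β * T - κ * T ^ 2 := by
  rcases eq_or_lt_of_le (le_trans hτT hTT) with heq | hlt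
  · have hT : T = T₀ := le_antisymm hTT (heq ▸ hτT)
    rw [hT]; exact h2
  · have key : (T₀ - τ) * (α + β * T - κ * T ^ 2)
        = (T₀ - T) * (α + β * τ - κ * τ ^ 2) + (T - τ) * (α + β * T₀ - κ * T₀ ^ 2) + κ * ((T - τ) * (T₀ - T) * (T₀ - τ)) := by ring
    have hnn : 0 ≤ (T₀ - τ) * (α + β * T - κ * T ^ 2) := by
      rw [key]
      have t1 : 0 ≤ (T₀ - T) * (α + β * τ - κ * τ ^ 2) := mul_nonneg (sub_nonneg.2 hTT) h1
      have t2 : 0 ≤ (T - τ) * (α + β * T₀ - κ * T₀ ^ 2) := mul_nonneg (sub_nonneg.2 hτT) h2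
      have t3 : 0 ≤ κ * ((T - τ) * (T₀ - T) * (T₀ - τ)) :=
        mul_nonneg hκ (mul_nonneg (mul_nonneg (sub_nonneg.2 hτT) (sub_nonneg.2 hTT)) (sub_nonneg.2 hlt.le))
      linarith
    exact nonneg_of_mul_nonneg_right hnn (sub_pos.2 hlt)

end LawDec
end Quant
end Summit.CriticalPhenomena.PercolationContinuityZ3.Theorems
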